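import Summits.CriticalPhenomena.SAWScalingLimit.Theorems.SAWLoopFugacityFlowIsingBoundaryRatioWindowResistanceDefs
import Literature.Probability.LatticeModels.FKIsingAnnulusCrossingRSW
import HarnessLib

/-!
# The side-to-side crossing bound of the lattice window from CDH16 Thm 1.1 (i)
(line `fk-anchor-transfer` of the crux `SAWLoopFugacityFlow.IsingBoundaryRatio`, stmt-CriticalPhenomena-10650)

We prove the registered stub
`halfAnnulusSideCrossingBound_of : fkIsing_topologicalRectangle_crossingBounds → discreteEL_ext_sandwich →
WindowRectPresentation → WindowExtResistanceBound → HalfAnnulusSideCrossingBound`.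

Probabilistic glue (`fkMeasure_openCrossing_le_annSideCross`). Chelkak–Duminil-Copin–Hongler 2016,
Thm 1.1 (i) bounds from below the probability, under the FREE critical FK-Ising measure
`DiscreteRect.fkMeasure E ∅` of a discrete topological rectangle `⟨E⟩` ON ITS OWN VERTEX TYPE `↥(verts E)`,
of an open crossing between two vertex sets `A`, `C`; the target speaks of the free critical FK-Ising
measure of the local graph `⟨U⟩`, `U = annEdgeFinset H Ann`, on the vertex type `↥Λ` of a finite volume,
and of the event `AnnSideCross H W L R` (an open walk of `H` inside the window `W` from `L` to `R`). The
comparison `fkMeasure E ∅ (A ↔ C) ≤ φ⁰_{⟨U⟩}(AnnSideCross H W L R)`, valid whenever the edges of `E` are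
`H`-edges between window sites (`W ⊆ Ann`) and `A`, `C` lie in `L`, `R`, is obtained in three steps:
(1) the rectangle's own measure is the free measure of `⟨E⟩` read on `↥Λ`, the other vertices being
isolated (`rcMeasure_real_map_image`: idle vertices do not matter for free boundary conditions; open
crossings correspond under the inclusion of vertex types, `map_image_mem_openCrossing_iff`);
(2) FREE MEASURES INCREASE WITH THE DOMAIN (`rcMeasure_fromEdgeSet_real_le`: Grimmett 2006, Thm (3.1)(a)
with positive association), from `⟨E⟩ ⊆ ⟨U⟩` on `↥Λ`, for the increasing crossing event;
(3) an open crossing of `⟨E⟩` read in `↥Λ` is an `AnnSideCross` (`annSideCross_of_mem_openCrossing`).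

Plumbing (`halfAnnulusSideCrossingBound_of`). Fix the chordal chart `φ` and `M > 1`;
`WindowExtResistanceBound` supplies `C = C(D, φ)`. The window radii are `r₁ = sρ`, `r₂ = Mρ/s`,
`s = M^{1/4}` (as in `HalfAnnulusSideCrossingBound`), and the inner radii are the thirds
`r₁' = (2r₁ + r₂)/3`, `r₂' = (r₁ + 2r₂)/3`, whose ratio `q = (s + 2M/s)/(2s + M/s) > 1` depends on `M`
only; put `L₁ = C / log q` and let `c = η(L₁)` be the constant of CDH16 Thm 1.1 (hypothesis
`fkIsing_topologicalRectangle_crossingBounds`). Given `ε`, take `ρ₀` below the `ρ₀`'s of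
`WindowRectPresentation` and `WindowExtResistanceBound`; for `ρ < ρ₀` and `δ` in both eventualities, a
finite volume `Λ` agreeing locally with `Ω_δ` and containing the chart disc of radius `Mρ` carries a
presentation `IsWindowRect … Λ E d₀ n` with `ℓ_Ω̄[(sides)] ≤ C / log (r₂'/r₁') = L₁`; the sandwich
(hypothesis `discreteEL_ext_sandwich`) gives `ℓ_Ω[(sides)] ≤ L₁`, so Thm 1.1 (i) bounds the free
`fkMeasure E ∅`-probability of an open crossing between the arcs `0` and `2` from below by `η`, and the
glue (with the fields `mem_edgeSet`, `mem_window`, `arc0_sub`, `arc2_sub` of `IsWindowRect`) transfers the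
bound to the free critical FK-Ising measure of `⟨annEdgeFinset H Ann⟩` on `↥Λ`, at the parameter
`1 - e^{-2β_c} = √2/(1+√2)` (`fkIsingParam_half_log`).

## References
* [ChelkakDuminilCopinHongler2016] D. Chelkak, H. Duminil-Copin, C. Hongler, *Crossing probabilities in
  topological rectangles for the critical planar FK-Ising model*, EJP 21 (2016), no. 5, Thm 1.1 (i),
  Rem. 2.2, §3.3.
* [Grimmett2006] G. Grimmett, *The Random-Cluster Model*, Springer 2006, Thm (3.1)(a), Lemma (4.13),
  Lemma (4.14).
-/

noncomputable section

open scoped Classical Topology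
open Filter Set Metric SimpleGraph MeasureTheory
open Literature.Probability.LatticeModels Literature.Probability.RandomPlanarGeometry
open Literature.Probability.Percolation (BondConfig openCrossing openGraph openGraph_adj)
open UpperHalfPlane (upperHalfPlaneSet)

namespace Summit.CriticalPhenomena.SAWScalingLimit.Theorems.IsingBoundaryRatio

/-! ### Vertices of a discrete domain -/

/-- The vertices of the discrete domain `E` are the endpoints of its edges. [folklore] -/
theorem mem_verts_iff {E : Finset (Sym2 (Site 2))} {x : Site 2} :
    x ∈ DiscreteRect.verts E ↔ ∃ e ∈ E, x ∈ e := by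
  unfold DiscreteRect.verts DiscreteRect.endpts
  simp only [Finset.mem_biUnion]
  refine exists_congr fun e => and_congr_right fun _ => ?_
  induction e using Sym2.ind with
  | h a b => simp [Sym2.lift_mk]

/-! ### From an open crossing read in the volume to `AnnSideCross` -/

section Transport

variable {V : Type*}

/-- A walk of the open graph of `ω'` inside `S`, all of whose edges are `H`-edges, is an `H`-walk inside
`S` with `ω'`-open edges. [folklore] -/
theorem exists_walk_of_walk_induce_openGraph (H : SimpleGraph V) {ω' : BondConfig V}
    (hω' : ∀ e ∈ ω', e ∈ H.edgeSet) (S : Set V) :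
    ∀ (a b : ↥S) (_ : ((openGraph ω').induce S).Walk a b),
      ∃ p : H.Walk a.1 b.1, (∀ z ∈ p.support, z ∈ S) ∧ ∀ e ∈ p.edges, e ∈ ω' := by
  intro a b q
  induction q with
  | nil =>
    rename_i u
    exact ⟨.nil, fun z hz => by rw [Walk.support_nil, List.mem_singleton] at hz; exact hz ▸ u.2,
      fun e he => by simp at he⟩
  | cons hadj _ ih =>
    rename_i u v w _
    obtain ⟨p, hs, he⟩ := ih
    have h1 : s(u.1, v.1) ∈ ω' ∧ u.1 ≠ v.1 := (openGraph_adj _ _ _).1 (induce_adj.1 hadj)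
    have hH : H.Adj u.1 v.1 := (mem_edgeSet H).1 (hω' _ h1.1)
    refine ⟨.cons hH p, fun z hz => ?_, fun e he' => ?_⟩
    · rw [Walk.support_cons, List.mem_cons] at hz
      rcases hz with rfl | hz
      · exact u.2
      · exact hs z hz
    · rw [Walk.edges_cons, List.mem_cons] at he'
      rcases he' with rfl | he'
      · exact h1.1
      · exact he e he'

/-- **An open crossing inside `S ⊆ W` from `A' ⊆ L` to `B' ⊆ R` by `H`-edges of `ω' ⊆ ω` is an
`AnnSideCross H W L R ω`.** [folklore] -/
theorem annSideCross_of_mem_openCrossing {Λ : Finset (Site 2)} (H : SimpleGraph Λ)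
    {W L R S A' B' : Set Λ} (hS : S ⊆ W) (hA : A' ⊆ L) (hB : B' ⊆ R) {ω ω' : BondConfig Λ}
    (hωω' : ω' ⊆ ω) (hω' : ∀ e ∈ ω', e ∈ H.edgeSet) (h : ω' ∈ openCrossing S A' B') :
    AnnSideCross H W L R ω := by
  obtain ⟨x, hx, y, hy, hxS, hyS, hr⟩ := h
  obtain ⟨q⟩ := hr
  obtain ⟨p, hs, he⟩ := exists_walk_of_walk_induce_openGraph H hω' S _ _ q
  exact ⟨x, hA hx, y, hB hy, p, fun z hz => hS (hs z hz), fun e he' => hωω' (he e he')⟩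

end Transport

/-! ### The measure comparison -/

section Comparison

variable {Λ : Finset (Site 2)}

/-- **CDH16's crossing event, read in the finite volume, is at most as likely as `AnnSideCross` under the
free measure of the local graph.** For a graph `H` on `↥Λ`, sets `W ⊆ Ann`, `L`, `R`, and a finite set
`E` of pairs of sites whose members are `H`-edges between sites of `W` (read in `Λ`), with `A`-vertices in
`L` and `C`-vertices in `R`: the probability under the free critical FK-Ising measure of `⟨E⟩` (on its
vertex type) of an open crossing from `A` to `C` is at most the probability under the free critical
FK-Ising measure of `⟨annEdgeFinset H Ann⟩` (vertex type `↥Λ`) of `AnnSideCross H W L R`.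
[cite: Grimmett2006, Thm. (3.1)(a) and Lemma (4.13)] -/
theorem fkMeasure_openCrossing_le_annSideCross (H : SimpleGraph Λ) (Ann W L R : Set Λ)
    (E : Finset (Sym2 (Site 2))) (A C : Set (Site 2)) (hWAnn : W ⊆ Ann)
    (hE : ∀ e ∈ E, ∀ x ∈ e, ∃ hx : x ∈ Λ, (⟨x, hx⟩ : ↥Λ) ∈ W)
    (hadj : ∀ (x y : Site 2) (hx : x ∈ Λ) (hy : y ∈ Λ), s(x, y) ∈ E → x ≠ y → H.Adj ⟨x, hx⟩ ⟨y, hy⟩)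
    (hA : ∀ x ∈ A, ∃ hx : x ∈ Λ, (⟨x, hx⟩ : ↥Λ) ∈ L)
    (hC : ∀ x ∈ C, ∃ hx : x ∈ Λ, (⟨x, hx⟩ : ↥Λ) ∈ R) :
    (DiscreteRect.fkMeasure E ∅).real
        (openCrossing Set.univ {x | x.1 ∈ A} {x | x.1 ∈ C}) ≤
      (rcMeasure (fromEdgeSet (↑(annEdgeFinset H Ann) : Set (Sym2 Λ))) criticalFKIsingParam 2 ∅).real
        {ω | AnnSideCross H W L R ω} := by
  classical
  have hp := criticalFKIsingParam_mem_Icc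
  -- every vertex of `E` is a window site of `Λ`
  have hV : ∀ x : ↥((DiscreteRect.verts E : Finset (Site 2)) : Set (Site 2)),
      ∃ hx : (x.1 : Site 2) ∈ Λ, (⟨x.1, hx⟩ : ↥Λ) ∈ W := fun x => by
    obtain ⟨e, he, hxe⟩ := mem_verts_iff.1 x.2
    exact hE e he x.1 hxe
  -- the inclusion of vertex types
  set j : ↥((DiscreteRect.verts E : Finset (Site 2)) : Set (Site 2)) ↪ ↥Λ :=
    ⟨fun x => ⟨x.1, (hV x).1⟩, fun x y hxy => Subtype.ext (Subtype.mk.inj hxy)⟩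
  have hjW : ∀ x, j x ∈ W := fun x => (hV x).2
  set G := DiscreteRect.graph E with hG
  -- the edges of `⟨E⟩`, read in `Λ`
  set U₀ : Finset (Sym2 ↥Λ) := G.edgeFinset.map j.sym2Map
  have hU₀mem : ∀ e ∈ U₀, e ∈ H.edgeSet ∧ ∀ v ∈ e, v ∈ W := by
    intro e he
    obtain ⟨e', he', rfl⟩ := Finset.mem_map.1 he
    induction e' using Sym2.ind with
    | h a b =>
      rw [mem_edgeFinset, mem_edgeSet] at he'
      have hab : s(a.1, b.1) ∈ E ∧ a.1 ≠ b.1 := by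
        have := he'
        rw [hG, DiscreteRect.graph, comap_adj, fromEdgeSet_adj, Finset.mem_coe] at this
        exact this
      refine ⟨?_, ?_⟩
      · rw [Function.Embedding.sym2Map_apply, Sym2.map_mk, mem_edgeSet]
        exact hadj a.1 b.1 _ _ hab.1 hab.2
      · intro v hv
        rw [Function.Embedding.sym2Map_apply, Sym2.map_mk, Sym2.mem_iff] at hv
        rcases hv with rfl | rfl
        · exact hjW a
        · exact hjW b
  have hU₀H : ∀ e ∈ U₀, e ∈ H.edgeSet := fun e he => (hU₀mem e he).1
  have hU₀sub : U₀ ⊆ annEdgeFinset H Ann := by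
    intro e he
    obtain ⟨h1, h2⟩ := hU₀mem e he
    induction e using Sym2.ind with
    | h a b => exact mem_annEdgeFinset.2 ⟨h1, a, hWAnn (h2 a (Sym2.mem_mk_left a b)), Sym2.mem_mk_left a b⟩
  have hAnnH : annEdgeFinset H Ann ⊆ H.edgeFinset := fun e he => by
    rw [mem_edgeFinset]; exact (mem_annEdgeFinset.1 he).1
  -- the ambient graph `⟨U⟩`, `U = annEdgeFinset H Ann`, with the generic `Fintype` instance of its
  -- edge set (as inside `rcMeasure`)
  set Gann : SimpleGraph ↥Λ := fromEdgeSet (↑(annEdgeFinset H Ann) : Set (Sym2 ↥Λ))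
  have hEann : @edgeFinset _ Gann Gann.fintypeEdgeSet = annEdgeFinset H Ann :=
    @edgeFinset_fromEdgeSet_of_subset _ _ H _ (annEdgeFinset H Ann) hAnnH (fintypeEdgeSet _)
  have hU₀amb : U₀ ⊆ @edgeFinset _ Gann Gann.fintypeEdgeSet := by rw [hEann]; exact hU₀sub
  -- the graph `⟨E⟩` read in `Λ`
  set G' : SimpleGraph ↥Λ := fromEdgeSet (↑U₀ : Set (Sym2 ↥Λ))
  have hE' : @edgeFinset _ G' G'.fintypeEdgeSet = G.edgeFinset.map j.sym2Map :=
    @edgeFinset_fromEdgeSet_of_subset _ _ Gann _ U₀ hU₀amb (fintypeEdgeSet _)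
  -- the crossing event read in `Λ`
  set A₁ : Set ↥((DiscreteRect.verts E : Finset (Site 2)) : Set (Site 2)) := {x | x.1 ∈ A}
  set C₁ : Set ↥((DiscreteRect.verts E : Finset (Site 2)) : Set (Site 2)) := {x | x.1 ∈ C}
  set A' : Set (BondConfig ↥Λ) := openCrossing (j '' Set.univ) (j '' A₁) (j '' C₁) with hA'
  have hA'up : IsUpperSet A' := Literature.Probability.Percolation.isUpperSet_openCrossing _ _ _
  -- step 1: the rectangle's own measure, read in `Λ`
  have step1 : (DiscreteRect.fkMeasure E ∅).real (openCrossing Set.univ A₁ C₁) =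
      (rcMeasure G' criticalFKIsingParam 2 ∅).real A' := by
    have h := rcMeasure_real_map_image (G := G) (G' := G') j hE' hp two_pos ∅
      (A := (openCrossing Set.univ A₁ C₁ :
        Set (BondConfig ↥((DiscreteRect.verts E : Finset (Site 2)) : Set (Site 2)))))
      (A' := A') fun ω _ => by
        rw [hA', coe_map_sym2Map]
        exact (Literature.Probability.LatticeModels.map_image_mem_openCrossing_iff j _ _ A₁ C₁).symm
    rw [Set.image_empty] at h
    rw [h]
    rfl
  -- step 2: free measures increase with the domain
  have h0 : 0 < (rcMeasure Gann criticalFKIsingParam 2 ∅).real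
      {ω | ω ∩ (↑U₀ : Set (Sym2 ↥Λ))ᶜ = ∅} :=
    rcMeasure_real_pos_of_empty_mem _ hp criticalFKIsingParam_mem_Ioo.2 two_pos ∅
      (by change (∅ : Set (Sym2 ↥Λ)) ∩ (↑U₀ : Set (Sym2 ↥Λ))ᶜ = ∅; exact Set.empty_inter _)
  have step2 := rcMeasure_fromEdgeSet_real_le Gann hp one_le_two ∅ U₀ hU₀amb h0 hA'up
  -- step 3: an open crossing of `⟨E⟩` read in `Λ` is an `AnnSideCross`
  haveI : IsProbabilityMeasure (rcMeasure Gann criticalFKIsingParam 2 ∅) :=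
    isProbabilityMeasure_rcMeasure _ hp two_pos _
  have hjA : j '' A₁ ⊆ L := by
    rintro _ ⟨x, hx, rfl⟩
    exact (hA x.1 hx).2
  have hjC : j '' C₁ ⊆ R := by
    rintro _ ⟨x, hx, rfl⟩
    exact (hC x.1 hx).2
  have hjS : j '' Set.univ ⊆ W := by
    rintro _ ⟨x, -, rfl⟩
    exact hjW x
  have step3 : (rcMeasure Gann criticalFKIsingParam 2 ∅).real {ω | ω ∩ ↑U₀ ∈ A'} ≤
      (rcMeasure Gann criticalFKIsingParam 2 ∅).real {ω | AnnSideCross H W L R ω} := by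
    refine measureReal_mono (fun ω hω => ?_) (measure_ne_top _ _)
    exact annSideCross_of_mem_openCrossing H hjS hjA hjC Set.inter_subset_left
      (fun e he => hU₀H e he.2) hω
  exact (le_of_eq step1).trans (step2.trans step3)

end Comparison

/-! ### The radii -/

/-- `s² < M` for `s = M^{1/4}`, `M > 1`. [folklore] -/
theorem sqrt_sqrt_mul_self_lt {M : ℝ} (hM : 1 < M) :
    Real.sqrt (Real.sqrt M) * Real.sqrt (Real.sqrt M) < M := by
  have hM0 : 0 < M := one_pos.trans hM
  rw [Real.mul_self_sqrt (Real.sqrt_nonneg M), Real.sqrt_lt' hM0]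
  nlinarith

/-- The window `r₁ = sρ < r₂ = Mρ/s` and its inner thirds `r₁' = (2r₁ + r₂)/3 < r₂' = (r₁ + 2r₂)/3`:
`ρ < r₁ < r₁' < r₂' < r₂ < Mρ`. [folklore] -/
theorem window_thirds_bounds {M ρ : ℝ} (hM : 1 < M) (hρ : 0 < ρ) :
    ρ < Real.sqrt (Real.sqrt M) * ρ ∧
      Real.sqrt (Real.sqrt M) * ρ <
        (2 * (Real.sqrt (Real.sqrt M) * ρ) + M * ρ / Real.sqrt (Real.sqrt M)) / 3 ∧
      (2 * (Real.sqrt (Real.sqrt M) * ρ) + M * ρ / Real.sqrt (Real.sqrt M)) / 3 <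
        (Real.sqrt (Real.sqrt M) * ρ + 2 * (M * ρ / Real.sqrt (Real.sqrt M))) / 3 ∧
      (Real.sqrt (Real.sqrt M) * ρ + 2 * (M * ρ / Real.sqrt (Real.sqrt M))) / 3 <
        M * ρ / Real.sqrt (Real.sqrt M) ∧
      M * ρ / Real.sqrt (Real.sqrt M) < M * ρ := by
  set s := Real.sqrt (Real.sqrt M) with hs
  have hss : s * s < M := sqrt_sqrt_mul_self_lt hM
  have hs1 : 1 < s := by
    rw [hs, Real.lt_sqrt zero_le_one, one_pow, Real.lt_sqrt zero_le_one, one_pow]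
    exact hM
  have hs0 : 0 < s := one_pos.trans hs1
  have hM0 : 0 < M := one_pos.trans hM
  have hab : s * ρ < M * ρ / s := by
    rw [lt_div_iff₀ hs0]
    calc s * ρ * s = (s * s) * ρ := by ring
      _ < M * ρ := mul_lt_mul_of_pos_right hss hρ
  refine ⟨by nlinarith, by linarith, by linarith, by linarith, ?_⟩
  rw [div_lt_iff₀ hs0]
  nlinarith [mul_pos hM0 hρ]

/-- The ratio of the inner thirds depends on `M` only. [folklore] -/
theorem window_thirds_ratio {M ρ : ℝ} (hM : 1 < M) (hρ : 0 < ρ) :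
    (Real.sqrt (Real.sqrt M) * ρ + 2 * (M * ρ / Real.sqrt (Real.sqrt M))) / 3 /
        ((2 * (Real.sqrt (Real.sqrt M) * ρ) + M * ρ / Real.sqrt (Real.sqrt M)) / 3) =
      (Real.sqrt (Real.sqrt M) + 2 * (M / Real.sqrt (Real.sqrt M))) /
        (2 * Real.sqrt (Real.sqrt M) + M / Real.sqrt (Real.sqrt M)) := by
  set s := Real.sqrt (Real.sqrt M) with hs
  have hs1 : 1 < s := by
    rw [hs, Real.lt_sqrt zero_le_one, one_pow, Real.lt_sqrt zero_le_one, one_pow]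
    exact hM
  have hs0 : 0 < s := one_pos.trans hs1
  have hM0 : 0 < M := one_pos.trans hM
  have hden : 0 < 2 * s + M / s := by positivity
  have hden' : 0 < (2 * (s * ρ) + M * ρ / s) / 3 := by positivity
  rw [div_eq_div_iff hden'.ne' hden.ne']
  field_simp

/-- The ratio of the inner thirds exceeds one. [folklore] -/
theorem one_lt_window_thirds_ratio {M : ℝ} (hM : 1 < M) :
    1 < (Real.sqrt (Real.sqrt M) + 2 * (M / Real.sqrt (Real.sqrt M))) /
        (2 * Real.sqrt (Real.sqrt M) + M / Real.sqrt (Real.sqrt M)) := by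
  set s := Real.sqrt (Real.sqrt M) with hs
  have hss : s * s < M := sqrt_sqrt_mul_self_lt hM
  have hs1 : 1 < s := by
    rw [hs, Real.lt_sqrt zero_le_one, one_pow, Real.lt_sqrt zero_le_one, one_pow]
    exact hM
  have hs0 : 0 < s := one_pos.trans hs1
  have hM0 : 0 < M := one_pos.trans hM
  have hden : 0 < 2 * s + M / s := by positivity
  rw [one_lt_div hden]
  have : s < M / s := by rw [lt_div_iff₀ hs0]; exact hss
  linarith

/-! ### The stub -/

/-- **The side-to-side crossing bound from CDH16 Thm 1.1 (i)** (registered stub of the line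
`fk-anchor-transfer`, stmt-CriticalPhenomena-10650): Chelkak–Duminil-Copin–Hongler 2016 Thm 1.1 and the
sandwich of §3.3 (hypotheses, named facts), together with the presentation of the lattice window as a
discrete topological rectangle and the resistance bound between the external arcs of its rough sides
(hypotheses, targets of the line), give `HalfAnnulusSideCrossingBound`. See the module docstring for the
plumbing. [cite: ChelkakDuminilCopinHongler2016, Theorem 1.1 (i) and Remark 2.2] -/
theorem halfAnnulusSideCrossingBound_of : fkIsing_topologicalRectangle_crossingBounds → discreteEL_ext_sandwich → WindowRectPresentation → WindowExtResistanceBound → HalfAnnulusSideCrossingBound := by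
  intro hCDH hSand hWRP hWERB D φ hφ M hM
  obtain ⟨C, hC, hWERB'⟩ := hWERB D φ hφ
  have hM0 : 0 < M := one_pos.trans hM
  -- the ratio of the inner radii and the resistance level
  have hq1 := one_lt_window_thirds_ratio hM
  have hlogq : 0 < Real.log ((Real.sqrt (Real.sqrt M) + 2 * (M / Real.sqrt (Real.sqrt M))) /
      (2 * Real.sqrt (Real.sqrt M) + M / Real.sqrt (Real.sqrt M))) := Real.log_pos hq1
  obtain ⟨η, hη0, -, hCDH'⟩ := hCDH _ (div_pos hC hlogq)
  refine ⟨η, hη0, fun ε hε => ?_⟩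
  obtain ⟨ρ₁, hρ₁, h1⟩ := hWRP D φ hφ M hM ε hε
  obtain ⟨ρ₂, hρ₂, h2⟩ := hWERB' M hM ε hε
  refine ⟨min ρ₁ ρ₂, lt_min hρ₁ hρ₂, fun ρ hρ hρlt => ?_⟩
  obtain ⟨hr1, hr11', hr1'2', hr2'2, hr2⟩ := window_thirds_bounds hM hρ
  have hratio := window_thirds_ratio hM hρ
  filter_upwards [h1 ρ hρ (hρlt.trans_le (min_le_left _ _)) _ _ _ _ hr1 hr11' hr1'2' hr2'2 hr2,
    h2 ρ hρ (hρlt.trans_le (min_le_right _ _)) _ _ _ _ hr1 hr11' hr1'2' hr2'2 hr2] with δ hδ1 hδ2 Λ hLA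
  intro H Ann s hvol
  -- the presentation and the resistance bound
  obtain ⟨E, d₀, n, hW⟩ := hδ1 Λ hLA hvol
  have hres := hδ2 Λ hLA hvol E d₀ n hW
  rw [hratio] at hres
  have hℓ := (hSand E d₀ n hW.isRect).1
  -- CDH16 Thm 1.1 (i)
  have hcdh := (hCDH' E d₀ n hW.isRect).1 (hℓ.trans hres)
  -- transfer to the local graph on `↥Λ`
  have hp_eq : (1 - Real.exp (-2 * criticalBetaTwo)) = criticalFKIsingParam := fkIsingParam_half_log
  rw [hp_eq]
  refine hcdh.trans (fkMeasure_openCrossing_le_annSideCross H Ann _ _ _ E _ _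
    (annWindow_subset_annBody D φ M ε δ ρ _ _ Λ) hW.mem_window (fun x y hx hy hxy _ => ?_)
    hW.arc0_sub hW.arc2_sub)
  have h := hW.mem_edgeSet _ hxy
  rw [mem_edgeSet] at h
  exact h

end Summit.CriticalPhenomena.SAWScalingLimit.Theorems.IsingBoundaryRatio

end
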